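import Mathlib
import Summits.AtomisticToContinuum.Crystallization.Theses.ReggeStarCoercivity

/-!
# `Assembly`
(route `ReggeStarCoercivity`, item `stmt-AtomisticToContinuum-13611`)

Pure logic: the load-bearing sub-chain of the route's deciding theorem `closes`.
`_root_.Crystallization` unfolds to
`HasPeriodicGroundStateEnergy lennardJones 3 ∧ IsCrystallizing lennardJones 3`;
the energetic conjunct is `EnergyLimitGlue` applied to `StarCoercivity`, `CrysEnergyUpper`,
`CrysPeriodicMinAttained`, and the positional conjunct is `DefectFreeCrystallizes` applied to the
zero-defect-density statement produced by `CoercivityForcesZeroDefects` (whose conclusion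
`ZeroDefectDensity` is by `rfl` the antecedent of `DefectFreeCrystallizes`).
-/

namespace Summit.AtomisticToContinuum.Crystallization.Theorems

open Summit.AtomisticToContinuum.Crystallization.Theses.ReggeStarCoercivity

/-- **`Assembly`** (item `stmt-AtomisticToContinuum-13611`, route `ReggeStarCoercivity`):
`StarCoercivity → CrysEnergyUpper → CrysPeriodicMinAttained → CoercivityForcesZeroDefects →
DefectFreeCrystallizes → EnergyLimitGlue → Crystallization`. The energetic conjunct of
`Crystallization` is `EnergyLimitGlue` fed with the first three hypotheses; the positional
conjunct is `DefectFreeCrystallizes` fed with `CoercivityForcesZeroDefects StarCoercivity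
CrysEnergyUpper : ZeroDefectDensity`. -/
theorem reggeStarCoercivity_assembly_proof :
    Summit.AtomisticToContinuum.Crystallization.Theses.ReggeStarCoercivity.Assembly := by
  unfold Assembly
  intro hSC hUp hMin hCFZ hDFC hELG
  exact ⟨hELG hSC hUp hMin, hDFC (hCFZ hSC hUp)⟩

end Summit.AtomisticToContinuum.Crystallization.Theorems
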